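import Mathlib
import HarnessLib

/-!
# Packing count for the points of an additive subgroup of a field in a `(σ₁, σ₂)`-box

Topic `NumberTheory/NumberFields`, namespace `Literature.NumberTheory.NumberFields`. Everything in
this file is PROVED (theorems only; no definitions, no named facts), and — like the packing of
relative minima in a dyadic range — it is stated WITHOUT number fields: `K` is any field with ring
homomorphisms `σ₁ : K →+* ℝ`, `σ₂ : K →+* ℂ` (in the application: a complex cubic field with its
real embedding and one of its two non-real embeddings) and `L ⊆ K` is any additive subgroup (in
the application: a fractional ideal, or any lattice containing `1`).

**The packing count.** Suppose the only points `u ∈ L` of the open box `|σ₁ u| < X₀`,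
`‖σ₂ u‖ < 1` lie in a finite set `S` (in the application `S = {0, 1, -1}`: "`1` is a relative
minimum of `L` and there is no relative minimum with `1 < σ₁ < X₀`"). Then for all `c₁ c₂ : ℕ` the
closed box `{u ∈ L : |σ₁ u| ≤ c₁ X₀, ‖σ₂ u‖ ≤ c₂}` is finite with at most
`#S · (2c₁ + 1) · (4c₂ + 1)²` points (`box_finite`, `ncard_box_le`, `box_finite_and_ncard_le`;
real radii: `box_finite_and_ncard_le_real`). Proof: index the cells of the grid
`σ₁ ∈ [k X₀, (k+1) X₀)`, `re σ₂ ∈ [m/2, (m+1)/2)`, `im σ₂ ∈ [m'/2, (m'+1)/2)` by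
`(k, m, m') ∈ ℤ³`; the box meets
`(2c₁+1)(4c₂+1)²` cells; two points of `L` in one cell differ by an element of `L` (a subgroup!)
lying in the open box (`|Δσ₁| < X₀`, `‖Δσ₂‖ < √(1/4 + 1/4) < 1`), i.e. by an element of `S`, so
`u ↦ (cell u, u - rep (cell u))` is injective from the box into `cells × S`.

**The successor witness** (`small_subset_of_gap`, `small_subset_of_le_of_lt`): if `0` is the
only point of `L` in the open unit box `|σ₁ u| < 1, ‖σ₂ u‖ < 1` and no `u ∈ L` has
`1 < σ₁ u < X`, `‖σ₂ u‖ < 1` (e.g. `X = σ₁ φ` for the SUCCESSOR `φ` of `1`: the element of `L`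
with `‖σ₂ φ‖ < 1`, `σ₁ φ > 1` and least `σ₁ φ`), then the open box `|σ₁ u| < X, ‖σ₂ u‖ < 1`
meets `L` inside `{0, 1, -1}` (the case `|σ₁ u| = 1` forces `u = ±1` by injectivity of `σ₁`;
the case `σ₁ u < -1` is excluded by passing to `-u`). Hence during a doubling search
`X = 2, 4, 8, … ≤ 2 σ₁ φ` for the successor, every box `{|σ₁ u| ≤ c₁ σ₁ φ, ‖σ₂ u‖ ≤ c₂}` holds
at most `3 (2c₁+1)(4c₂+1)²` points of `L` (`box_finite_and_ncard_le_of_gap`,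
`box_finite_and_ncard_le_of_le_of_lt`) — a constant, which is
what makes the enumeration step of Voronoi's / Buchmann–Williams' successor computation in a
complex cubic field polynomial.

Sources: the covering-by-half-boxes argument is the standard proof that a discrete set with a
forbidden difference body has bounded density (e.g. the proof of Blichfeldt's / Minkowski's
theorem); its use for relative minima of cubic lattices is implicit in G. Voronoi (1896) and
B. N. Delone, D. K. Faddeev, *The theory of irrationalities of the third degree*, Transl. Math.
Monographs 10 (1964), Ch. IV, and in H. C. Williams, G. W. Dueck, B. K. Schmid, Math. Comp. 41
(1983) §§2–3; J. Buchmann, H. C. Williams, *On principal ideal testing in algebraic number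
fields*, J. Symbolic Comput. 4 (1987). No single printed statement is followed: [folklore].

Not here: number fields, relative minima, the successor itself (see
`Literature.NumberTheory.CubicFields.VoronoiRelativeMinima` / `VoronoiChain`), LLL enumeration.
-/

namespace Literature.NumberTheory.NumberFields

open Set

section Cells

/-- Two complex numbers in the same half-open square of side `1/2` (same `⌊2 re⌋` and same
`⌊2 im⌋`) differ by a vector of norm `< 1` (indeed `< √2 / 2`). [folklore] -/
theorem norm_sub_lt_one_of_floor_eq {z w : ℂ} (hre : ⌊2 * z.re⌋ = ⌊2 * w.re⌋)
    (him : ⌊2 * z.im⌋ = ⌊2 * w.im⌋) : ‖z - w‖ < 1 := by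
  have h1 := Int.abs_sub_lt_one_of_floor_eq_floor hre
  have h2 := Int.abs_sub_lt_one_of_floor_eq_floor him
  rw [← mul_sub, abs_mul, abs_two] at h1 h2
  have hre' : |(z - w).re| < 1 / 2 := by rw [Complex.sub_re]; linarith
  have him' : |(z - w).im| < 1 / 2 := by rw [Complex.sub_im]; linarith
  have hsq : ‖z - w‖ ^ 2 < 1 := by
    rw [Complex.sq_norm, Complex.normSq_apply]
    have e1 := abs_lt.mp hre'
    have e2 := abs_lt.mp him'
    nlinarith
  exact lt_of_pow_lt_pow_left₀ 2 zero_le_one (by rwa [one_pow])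

/-- The cell index `⌊a / X₀⌋` of a real number with `|a| ≤ c X₀` lies in `[-c, c]`. [folklore] -/
theorem floor_div_mem_Icc {X₀ : ℝ} (hX₀ : 0 < X₀) {a : ℝ} {c : ℕ} (h : |a| ≤ c * X₀) :
    ⌊a / X₀⌋ ∈ Finset.Icc (-(c : ℤ)) c := by
  rw [Finset.mem_Icc]
  obtain ⟨h1, h2⟩ := abs_le.mp h
  constructor
  · rw [Int.le_floor, le_div_iff₀ hX₀]
    push_cast
    linarith
  · have : a / X₀ ≤ (c : ℤ) := by
      rw [div_le_iff₀ hX₀]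
      push_cast
      exact h2
    have := Int.floor_mono this
    rwa [Int.floor_intCast] at this

/-- The cell index `⌊2 t⌋` of a real number with `|t| ≤ c` lies in `[-2c, 2c]`. [folklore] -/
theorem floor_two_mul_mem_Icc {t : ℝ} {c : ℕ} (h : |t| ≤ c) :
    ⌊2 * t⌋ ∈ Finset.Icc (-(2 * c : ℤ)) (2 * c) := by
  rw [Finset.mem_Icc]
  obtain ⟨h1, h2⟩ := abs_le.mp h
  constructor
  · rw [Int.le_floor]
    push_cast
    linarith
  · have : 2 * t ≤ ((2 * c : ℤ) : ℝ) := by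
      push_cast
      linarith
    have := Int.floor_mono this
    rwa [Int.floor_intCast] at this

end Cells

section Packing

variable {K : Type*} [Field K] (σ₁ : K →+* ℝ) (σ₂ : K →+* ℂ) (L : AddSubgroup K)

/-- **Packing count** (finiteness and bound together). Let `L` be an additive subgroup of a field
`K` with ring homomorphisms `σ₁ : K → ℝ`, `σ₂ : K → ℂ`, let `X₀ > 0`, and suppose every `u ∈ L`
with `|σ₁ u| < X₀` and `‖σ₂ u‖ < 1` lies in the finite set `S`. Then for `c₁ c₂ : ℕ` the set of
`u ∈ L` with `|σ₁ u| ≤ c₁ X₀` and `‖σ₂ u‖ ≤ c₂` is finite and has at most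
`#S · (2c₁ + 1) · (4c₂ + 1)²` elements: with the cell index
`u ↦ (⌊σ₁ u / X₀⌋, ⌊2 re σ₂ u⌋, ⌊2 im σ₂ u⌋) ∈ [-c₁, c₁] × [-2c₂, 2c₂]²` and a chosen representative
`rep p` of every nonempty cell `p`, the map `u ↦ (cell u, u - rep (cell u))` is injective on the
box and takes values in `cells × S`, because two points of `L` in one cell differ by an element of
`L` with `|σ₁| < X₀` and `‖σ₂‖ < 1`. [folklore] -/
theorem box_finite_and_ncard_le {X₀ : ℝ} (hX₀ : 0 < X₀) {S : Set K} (hS : S.Finite)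
    (hT : {u : K | u ∈ L ∧ |σ₁ u| < X₀ ∧ ‖σ₂ u‖ < 1} ⊆ S) (c₁ c₂ : ℕ) :
    {u : K | u ∈ L ∧ |σ₁ u| ≤ c₁ * X₀ ∧ ‖σ₂ u‖ ≤ c₂}.Finite ∧
      {u : K | u ∈ L ∧ |σ₁ u| ≤ c₁ * X₀ ∧ ‖σ₂ u‖ ≤ c₂}.ncard ≤
        S.ncard * (2 * c₁ + 1) * (4 * c₂ + 1) ^ 2 := by
  classical
  set R : Set K := {u : K | u ∈ L ∧ |σ₁ u| ≤ c₁ * X₀ ∧ ‖σ₂ u‖ ≤ c₂} with hR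
  -- the cell index
  set f : K → ℤ × ℤ × ℤ := fun u => (⌊σ₁ u / X₀⌋, ⌊2 * (σ₂ u).re⌋, ⌊2 * (σ₂ u).im⌋) with hf
  -- a representative of every nonempty cell
  have hrep : ∀ p : ℤ × ℤ × ℤ, ∃ r : K, (∃ u ∈ R, f u = p) → r ∈ R ∧ f r = p := by
    intro p
    by_cases h : ∃ u ∈ R, f u = p
    · obtain ⟨u, hu, hfu⟩ := h
      exact ⟨u, fun _ => ⟨hu, hfu⟩⟩
    · exact ⟨0, fun h' => absurd h' h⟩
  choose r hr using hrep
  set g : K → (ℤ × ℤ × ℤ) × K := fun u => (f u, u - r (f u)) with hg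
  set B : Finset (ℤ × ℤ × ℤ) := Finset.Icc (-(c₁ : ℤ)) c₁ ×ˢ
    (Finset.Icc (-(2 * c₂ : ℤ)) (2 * c₂) ×ˢ Finset.Icc (-(2 * c₂ : ℤ)) (2 * c₂)) with hB
  -- two points of `L` in the same cell differ by an element of `S`
  have hdiff : ∀ u ∈ R, ∀ v ∈ R, f u = f v → u - v ∈ S := by
    rintro u ⟨huL, -, -⟩ v ⟨hvL, -, -⟩ huv
    simp only [hf, Prod.mk.injEq] at huv
    obtain ⟨h1, h2, h3⟩ := huv
    refine hT ⟨L.sub_mem huL hvL, ?_, ?_⟩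
    · -- same `σ₁`-cell: `|σ₁ u - σ₁ v| < X₀` (cf. the binning lemma
      -- `Literature.NumberTheory.LFunctions.PairCorrelationSmallGaps.abs_sub_lt_of_floor_div_eq`)
      have h1' := Int.abs_sub_lt_one_of_floor_eq_floor h1
      rwa [← sub_div, abs_div, abs_of_pos hX₀, div_lt_one hX₀, ← map_sub] at h1'
    · rw [map_sub]
      exact norm_sub_lt_one_of_floor_eq h2 h3
  have hmaps : MapsTo g R ((B : Set (ℤ × ℤ × ℤ)) ×ˢ S) := by
    intro u hu
    refine ⟨?_, ?_⟩
    · obtain ⟨-, hu1, hu2⟩ := hu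
      simp only [hg, hf, hB, Finset.coe_product, Finset.coe_Icc, Set.mem_prod, Set.mem_Icc,
        ← Finset.mem_Icc]
      exact ⟨floor_div_mem_Icc hX₀ hu1,
        floor_two_mul_mem_Icc ((Complex.abs_re_le_norm _).trans hu2),
        floor_two_mul_mem_Icc ((Complex.abs_im_le_norm _).trans hu2)⟩
    · exact hdiff u hu (r (f u)) (hr (f u) ⟨u, hu, rfl⟩).1 (hr (f u) ⟨u, hu, rfl⟩).2.symm
  have hinj : InjOn g R := by
    intro u _ v _ huv
    simp only [hg, Prod.mk.injEq] at huv
    obtain ⟨h1, h2⟩ := huv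
    rw [h1] at h2
    exact sub_left_injective h2
  have hfin : ((B : Set (ℤ × ℤ × ℤ)) ×ˢ S).Finite := (Finset.finite_toSet B).prod hS
  refine ⟨Finite.of_injOn hmaps hinj hfin, ?_⟩
  have hcard : B.card = (2 * c₁ + 1) * (4 * c₂ + 1) ^ 2 := by
    simp only [hB, Finset.card_product, Int.card_Icc]
    have e1 : ((c₁ : ℤ) + 1 - -(c₁ : ℤ)).toNat = 2 * c₁ + 1 := by omega
    have e2 : ((2 * c₂ : ℤ) + 1 - -(2 * c₂ : ℤ)).toNat = 4 * c₂ + 1 := by omega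
    rw [e1, e2]
    ring
  calc R.ncard ≤ ((B : Set (ℤ × ℤ × ℤ)) ×ˢ S).ncard := ncard_le_ncard_of_injOn g hmaps hinj hfin
    _ = S.ncard * (2 * c₁ + 1) * (4 * c₂ + 1) ^ 2 := by
        rw [ncard_prod, ncard_coe_finset, hcard]
        ring

/-- **Finiteness of the box**: under the hypotheses of `box_finite_and_ncard_le`, the set
`{u ∈ L : |σ₁ u| ≤ c₁ X₀, ‖σ₂ u‖ ≤ c₂}` is finite. [folklore] -/
theorem box_finite {X₀ : ℝ} (hX₀ : 0 < X₀) {S : Set K} (hS : S.Finite)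
    (hT : {u : K | u ∈ L ∧ |σ₁ u| < X₀ ∧ ‖σ₂ u‖ < 1} ⊆ S) (c₁ c₂ : ℕ) :
    {u : K | u ∈ L ∧ |σ₁ u| ≤ c₁ * X₀ ∧ ‖σ₂ u‖ ≤ c₂}.Finite :=
  (box_finite_and_ncard_le σ₁ σ₂ L hX₀ hS hT c₁ c₂).1

/-- **Packing count.** Let `L` be an additive subgroup of a field `K` with ring homomorphisms
`σ₁ : K → ℝ`, `σ₂ : K → ℂ`, let `X₀ > 0`, and suppose every `u ∈ L` with `|σ₁ u| < X₀` and
`‖σ₂ u‖ < 1` lies in the finite set `S`. Then for all `c₁ c₂ : ℕ`,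
`#{u ∈ L : |σ₁ u| ≤ c₁ X₀, ‖σ₂ u‖ ≤ c₂} ≤ #S · (2c₁ + 1) · (4c₂ + 1)²`. [folklore] -/
theorem ncard_box_le {X₀ : ℝ} (hX₀ : 0 < X₀) {S : Set K} (hS : S.Finite)
    (hT : {u : K | u ∈ L ∧ |σ₁ u| < X₀ ∧ ‖σ₂ u‖ < 1} ⊆ S) (c₁ c₂ : ℕ) :
    {u : K | u ∈ L ∧ |σ₁ u| ≤ c₁ * X₀ ∧ ‖σ₂ u‖ ≤ c₂}.ncard ≤
      S.ncard * (2 * c₁ + 1) * (4 * c₂ + 1) ^ 2 :=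
  (box_finite_and_ncard_le σ₁ σ₂ L hX₀ hS hT c₁ c₂).2

/-- **Packing count, real radii**: under the same hypotheses, for all real `A`, `B`,
`#{u ∈ L : |σ₁ u| ≤ A, ‖σ₂ u‖ ≤ B} ≤ #S · (2⌈A / X₀⌉₊ + 1) · (4⌈B⌉₊ + 1)²` (and the set is
finite), by enlarging the box to `c₁ = ⌈A / X₀⌉₊`, `c₂ = ⌈B⌉₊`. [folklore] -/
theorem box_finite_and_ncard_le_real {X₀ : ℝ} (hX₀ : 0 < X₀) {S : Set K} (hS : S.Finite)
    (hT : {u : K | u ∈ L ∧ |σ₁ u| < X₀ ∧ ‖σ₂ u‖ < 1} ⊆ S) (A B : ℝ) :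
    {u : K | u ∈ L ∧ |σ₁ u| ≤ A ∧ ‖σ₂ u‖ ≤ B}.Finite ∧
      {u : K | u ∈ L ∧ |σ₁ u| ≤ A ∧ ‖σ₂ u‖ ≤ B}.ncard ≤
        S.ncard * (2 * ⌈A / X₀⌉₊ + 1) * (4 * ⌈B⌉₊ + 1) ^ 2 := by
  have hsub : {u : K | u ∈ L ∧ |σ₁ u| ≤ A ∧ ‖σ₂ u‖ ≤ B} ⊆
      {u : K | u ∈ L ∧ |σ₁ u| ≤ (⌈A / X₀⌉₊ : ℕ) * X₀ ∧ ‖σ₂ u‖ ≤ (⌈B⌉₊ : ℕ)} := by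
    rintro u ⟨huL, hu1, hu2⟩
    refine ⟨huL, hu1.trans ?_, hu2.trans (Nat.le_ceil B)⟩
    rw [← div_le_iff₀ hX₀]
    exact Nat.le_ceil _
  obtain ⟨hfin, hle⟩ := box_finite_and_ncard_le σ₁ σ₂ L hX₀ hS hT ⌈A / X₀⌉₊ ⌈B⌉₊
  exact ⟨hfin.subset hsub, (ncard_le_ncard hsub hfin).trans hle⟩

/-- **The open box below a gap meets `L` inside `{0, 1, -1}`.** If `0` is the only point of `L`
in the open unit box (`|σ₁ u| < 1`, `‖σ₂ u‖ < 1`; "`1` is a relative minimum of `L`" when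
`1 ∈ L`) and no `u ∈ L` has `1 < σ₁ u < X` and `‖σ₂ u‖ < 1`, then every `u ∈ L` with
`|σ₁ u| < X` and `‖σ₂ u‖ < 1` is `0`, `1` or `-1`: if `|σ₁ u| < 1` then `u = 0`; if `|σ₁ u| = 1`
then `σ₁ u = σ₁ (±1)` and `σ₁` is injective; if `σ₁ u > 1` the gap hypothesis is violated by `u`,
and if `σ₁ u < -1` by `-u ∈ L`. [folklore] -/
theorem small_subset_of_gap {X : ℝ} (h1 : ∀ u ∈ L, |σ₁ u| < 1 → ‖σ₂ u‖ < 1 → u = 0)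
    (hgap : ∀ u ∈ L, 1 < σ₁ u → σ₁ u < X → 1 ≤ ‖σ₂ u‖) :
    {u : K | u ∈ L ∧ |σ₁ u| < X ∧ ‖σ₂ u‖ < 1} ⊆ {0, 1, -1} := by
  rintro u ⟨huL, huX, hu1⟩
  simp only [Set.mem_insert_iff, Set.mem_singleton_iff]
  rcases lt_trichotomy |σ₁ u| 1 with hlt | heq | hgt
  · exact Or.inl (h1 u huL hlt hu1)
  · right
    rcases (abs_eq zero_le_one).mp heq with h | h
    · exact Or.inl (σ₁.injective (by rw [h, map_one]))
    · exact Or.inr (σ₁.injective (by rw [h, map_neg, map_one]))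
  · exfalso
    obtain ⟨hX1, hX2⟩ := abs_lt.mp huX
    rcases lt_abs.mp hgt with h | h
    · exact absurd (hgap u huL h hX2) (not_le.mpr hu1)
    · have := hgap (-u) (L.neg_mem huL) (by rw [map_neg]; exact h) (by rw [map_neg]; linarith)
      rw [map_neg, norm_neg] at this
      exact absurd this (not_le.mpr hu1)

/-- **Successor witness.** If `0` is the only point of `L` in the open unit box and `φ` is
`σ₁`-minimal among the `u ∈ L` with `σ₁ u > 1` and `‖σ₂ u‖ < 1` (for instance the successor of
the relative minimum `1` in Voronoi's chain), then the open box `|σ₁ u| < σ₁ φ`, `‖σ₂ u‖ < 1`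
meets `L` inside `{0, 1, -1}`. [folklore] -/
theorem small_subset_of_le_of_lt {φ : K} (h1 : ∀ u ∈ L, |σ₁ u| < 1 → ‖σ₂ u‖ < 1 → u = 0)
    (hφ : ∀ u ∈ L, 1 < σ₁ u → ‖σ₂ u‖ < 1 → σ₁ φ ≤ σ₁ u) :
    {u : K | u ∈ L ∧ |σ₁ u| < σ₁ φ ∧ ‖σ₂ u‖ < 1} ⊆ {0, 1, -1} :=
  small_subset_of_gap σ₁ σ₂ L h1 fun u huL hu1 huφ =>
    not_lt.mp fun hu2 => absurd (hφ u huL hu1 hu2) (not_le.mpr huφ)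

/-- `{0, 1, -1}` has at most three elements. [folklore] -/
theorem ncard_zero_one_neg_one_le : ({0, 1, -1} : Set K).ncard ≤ 3 :=
  (ncard_insert_le _ _).trans <| Nat.succ_le_succ <|
    (ncard_insert_le _ _).trans <| Nat.succ_le_succ (ncard_singleton _).le

/-- **Packing count below a gap**: if `0` is the only point of `L` in the open unit box and no
`u ∈ L` has `1 < σ₁ u < X₀`, `‖σ₂ u‖ < 1` (`X₀ > 0`), then for all `c₁ c₂ : ℕ` the box
`{u ∈ L : |σ₁ u| ≤ c₁ X₀, ‖σ₂ u‖ ≤ c₂}` is finite with at most `3 (2c₁ + 1) (4c₂ + 1)²` points.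
[folklore] -/
theorem box_finite_and_ncard_le_of_gap {X₀ : ℝ} (hX₀ : 0 < X₀)
    (h1 : ∀ u ∈ L, |σ₁ u| < 1 → ‖σ₂ u‖ < 1 → u = 0)
    (hgap : ∀ u ∈ L, 1 < σ₁ u → σ₁ u < X₀ → 1 ≤ ‖σ₂ u‖) (c₁ c₂ : ℕ) :
    {u : K | u ∈ L ∧ |σ₁ u| ≤ c₁ * X₀ ∧ ‖σ₂ u‖ ≤ c₂}.Finite ∧
      {u : K | u ∈ L ∧ |σ₁ u| ≤ c₁ * X₀ ∧ ‖σ₂ u‖ ≤ c₂}.ncard ≤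
        3 * (2 * c₁ + 1) * (4 * c₂ + 1) ^ 2 := by
  have hS : ({0, 1, -1} : Set K).Finite := by simp
  obtain ⟨hfin, hle⟩ := box_finite_and_ncard_le σ₁ σ₂ L hX₀ hS
    (small_subset_of_gap σ₁ σ₂ L h1 hgap) c₁ c₂
  refine ⟨hfin, hle.trans ?_⟩
  gcongr
  exact ncard_zero_one_neg_one_le

/-- **Packing count during the successor search.** If `0` is the only point of `L` in the open
unit box and `φ` is `σ₁`-minimal among the `u ∈ L` with `σ₁ u > 1`, `‖σ₂ u‖ < 1`, with
`σ₁ φ > 0`, then every box `{u ∈ L : |σ₁ u| ≤ c₁ σ₁ φ, ‖σ₂ u‖ ≤ c₂}` (`c₁ c₂ : ℕ`) is finite with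
at most `3 (2c₁ + 1) (4c₂ + 1)²` points — a bound independent of `L`, `φ` and the field.
[folklore] -/
theorem box_finite_and_ncard_le_of_le_of_lt {φ : K} (hφ0 : 0 < σ₁ φ)
    (h1 : ∀ u ∈ L, |σ₁ u| < 1 → ‖σ₂ u‖ < 1 → u = 0)
    (hφ : ∀ u ∈ L, 1 < σ₁ u → ‖σ₂ u‖ < 1 → σ₁ φ ≤ σ₁ u) (c₁ c₂ : ℕ) :
    {u : K | u ∈ L ∧ |σ₁ u| ≤ c₁ * σ₁ φ ∧ ‖σ₂ u‖ ≤ c₂}.Finite ∧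
      {u : K | u ∈ L ∧ |σ₁ u| ≤ c₁ * σ₁ φ ∧ ‖σ₂ u‖ ≤ c₂}.ncard ≤
        3 * (2 * c₁ + 1) * (4 * c₂ + 1) ^ 2 :=
  box_finite_and_ncard_le_of_gap σ₁ σ₂ L hφ0 h1 (fun u huL hu1 huφ =>
    not_lt.mp fun hu2 => absurd (hφ u huL hu1 hu2) (not_le.mpr huφ)) c₁ c₂

end Packing

end Literature.NumberTheory.NumberFields
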